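import Summits.RiemannHypothesis.RiemannHypothesis.Theses.SpectralTrace
import Summits.RiemannHypothesis.RiemannHypothesis.Theorems.WindowTraceArch.Negative.UnitMass
import Summits.RiemannHypothesis.RiemannHypothesis.Theorems.WindowTraceArch.Negative.ComplexSpectrum
import Literature.NumberTheory.LFunctions.UniformWeilPositivityRH
import HarnessLib

/-!
# RiemannHypothesis / SpectralTrace — the support item `WindowCompactness` (the ladder implies X)

Route `RiemannHypothesis/SpectralTrace`, item stmt-RiemannHypothesis-11197 (`WindowCompactness`,
support, rank 9):

  `(∀ A > 0, ∃ (ι : Type) (γ : ι → ℝ), ∀ Weil g, tsupport g ⊆ [-A, A] →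
      HasSum (i ↦ ĝ(1/2 + iγ_i)) (W g)) →
   ∃ (ι : Type) (γ : ι → ℝ), ∀ Weil g, HasSum (i ↦ ĝ(1/2 + iγ_i)) (W g)`.

If every window `[-A, A]` carries a real family reproducing the Weil functional `W` on the Weil
tests supported there (the "ladder" `Trace(A)`, with NO coherence between rungs), then some real
family reproduces `W` on ALL Weil tests (the route target `X = SpectralThesis`).

The route card suggests Helly selection of the counting measures plus integrality of vague
limits. None of that is needed: the ladder is RH-strong, and RH calibrates `X` directly.

1. `weilPositivityOn_of_ladder` — a rung `Trace(2a)` forces Weil positivity on `[-a, a]`: for a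
   Weil test `g` supported in `[-a, a]`, `k = g ⋆ g̃` is a Weil test supported in `[-2a, 2a]`
   with `k̂(1/2 + iγ) = |ĝ(1/2 + iγ)|²`, so `Re Q(g) = Re W(k) = Σ_i |ĝ(1/2 + iγ_i)|² ≥ 0`
   (Bochner form `hasSum_norm_sq_of_windowTrace`, `Theorems/WindowTraceArch/Negative/UnitMass`).
2. `riemannHypothesis_of_ladder` — hence `∀ a > 0, WeilPositivityOn a`, which is the Riemann
   hypothesis by Yoshida's form of Weil's criterion, proved unconditionally in the tree
   (`Literature.NumberTheory.LFunctions.riemannHypothesis_iff_forall_weilPositivityOn`, from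
   `weil_criterion_holds`; Bombieri 2000 Thm. 2, Yoshida 1992).
3. `spectralThesis_of_riemannHypothesis` — under RH the ordinates `Im ρ` of the non-trivial
   zeros, repeated with multiplicity, reproduce `W` on every Weil test: the Guinand–Weil explicit
   formula with absolute convergence regrouped on `Σ ρ, Fin m(ρ)` (`hasSum_weilMellin_zeros`,
   `Theorems/WindowTraceArch/Negative/ComplexSpectrum`) and `ρ = 1/2 + i·Im ρ` under RH
   (`eq_half_add_of_riemannHypothesis`).
4. `windowCompactness_proof` — composition, with the literal route type.

References: E. Bombieri, Rend. Lincei (9) 11 (2000) 183–233, Thms. 1–2; H. Yoshida, Adv. Stud.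
Pure Math. 21 (1992); A. Weil, Comm. Sém. Math. Univ. Lund (1952) 252–265.
-/

noncomputable section

open Complex Set

namespace Summit.RiemannHypothesis.RiemannHypothesis.Theorems

open Literature.NumberTheory.LFunctions
open Summit.RiemannHypothesis.RiemannHypothesis.Theses.SpectralTrace
open Summit.RiemannHypothesis.RiemannHypothesis.Theorems.WindowTraceArch.Negative

/-- **A rung of the ladder forces Weil positivity on the half window.** If some real family
reproduces `W` on the Weil tests supported in `[-2a, 2a]`, then `Re Q(g) ≥ 0` for every Weil test
`g` supported in `[-a, a]`: `Re Q(g) = Σ_i |ĝ(1/2 + iγ_i)|²` (Bochner form of the window trace,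
`hasSum_norm_sq_of_windowTrace`) and a `HasSum` of non-negative reals is non-negative.
[Bombieri2000Weil, Thm. 1 (easy half, on a window)] -/
theorem weilPositivityOn_of_windowTrace {a : ℝ} {ι : Type*} {γ : ι → ℝ}
    (hγ : ∀ g : ℝ → ℂ, IsWeilTest g → tsupport g ⊆ Icc (-(2 * a)) (2 * a) →
      HasSum (fun i => weilMellin g (1 / 2 + (γ i : ℂ) * I)) (weilFunctional g)) :
    WeilPositivityOn a := by
  intro g hg hgs
  have hgs' : tsupport g ⊆ Icc (-(2 * a / 2)) (2 * a / 2) := by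
    rwa [show 2 * a / 2 = a by ring]
  exact (hasSum_norm_sq_of_windowTrace hγ hg hgs').nonneg fun _ => by positivity

/-- **The ladder forces uniform Weil positivity**: if every window `[-A, A]`, `A > 0`, carries a
real family reproducing `W` on the Weil tests supported there, then `WeilPositivityOn a` for every
`a > 0` (use the rung `A = 2a` and `weilPositivityOn_of_windowTrace`).
[Bombieri2000Weil, Thm. 1 (easy half, on a window)] -/
theorem weilPositivityOn_of_ladder
    (hladder : ∀ A : ℝ, 0 < A → ∃ (ι : Type) (γ : ι → ℝ), ∀ g : ℝ → ℂ, IsWeilTest g →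
      tsupport g ⊆ Icc (-A) A →
        HasSum (fun i => weilMellin g (1 / 2 + (γ i : ℂ) * I)) (weilFunctional g))
    {a : ℝ} (ha : 0 < a) : WeilPositivityOn a := by
  obtain ⟨ι, γ, hγ⟩ := hladder (2 * a) (by positivity)
  exact weilPositivityOn_of_windowTrace hγ

/-- **The ladder proves the Riemann hypothesis**: uniform Weil positivity
(`weilPositivityOn_of_ladder`) is RH by Yoshida's form of Weil's criterion, unconditional in the
tree (`riemannHypothesis_iff_forall_weilPositivityOn`). [Bombieri2000Weil, Thm. 2] -/
theorem riemannHypothesis_of_ladder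
    (hladder : ∀ A : ℝ, 0 < A → ∃ (ι : Type) (γ : ι → ℝ), ∀ g : ℝ → ℂ, IsWeilTest g →
      tsupport g ⊆ Icc (-A) A →
        HasSum (fun i => weilMellin g (1 / 2 + (γ i : ℂ) * I)) (weilFunctional g)) :
    _root_.RiemannHypothesis :=
  riemannHypothesis_iff_forall_weilPositivityOn.2 fun _ ha => weilPositivityOn_of_ladder hladder ha

/-- **Calibration `RH → X`**: under the Riemann hypothesis the ordinates `Im ρ` of the
non-trivial zeros of `ζ`, indexed by `Σ ρ, Fin m(ρ)` (repeated with multiplicity), form a real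
family with `HasSum (p ↦ ĝ(1/2 + i·Im ρ_p)) (W g)` for every Weil test `g` — the explicit
formula with absolute convergence (`hasSum_weilMellin_zeros`) read on the critical line
(`eq_half_add_of_riemannHypothesis`). [Bombieri2000Weil, Thm. 2 with x = e^t (explicit formula)] -/
theorem spectralThesis_of_riemannHypothesis (hRH : _root_.RiemannHypothesis) :
    ∃ (ι : Type) (γ : ι → ℝ), ∀ g : ℝ → ℂ, IsWeilTest g →
      HasSum (fun i => weilMellin g (1 / 2 + (γ i : ℂ) * I)) (weilFunctional g) := by
  refine ⟨(Σ ρ : ZetaZeros.riemannZetaNontrivialZeros, Fin (riemannZetaZeroOrder (ρ : ℂ)).toNat),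
    fun p => (p.1 : ℂ).im, fun g hg => ?_⟩
  simpa only [eq_half_add_of_riemannHypothesis hRH] using hasSum_weilMellin_zeros hg

/-- **Support item `WindowCompactness` (stmt-RiemannHypothesis-11197): the ladder implies X.**
If for every `A > 0` some real family reproduces the Weil functional on the Weil tests supported
in `[-A, A]`, then some real family reproduces it on all Weil tests. Proof: the ladder gives
uniform Weil positivity, hence RH (`riemannHypothesis_of_ladder`), and under RH the zero
ordinates with multiplicity are such a family (`spectralThesis_of_riemannHypothesis`); no
compactness / vague-limit argument is required. [Bombieri2000Weil, Thms. 1–2] -/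
theorem windowCompactness_proof : WindowCompactness := by
  unfold WindowCompactness
  intro hladder
  exact spectralThesis_of_riemannHypothesis (riemannHypothesis_of_ladder hladder)

end Summit.RiemannHypothesis.RiemannHypothesis.Theorems

end
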